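import Literature.Probability.LatticeModels.InterfaceSLETightness
import HarnessLib

/-!
# The spin-Ising traversal bound (C1): what the all-interfaces form reduces to

Topic `Literature/Probability/LatticeModels` (trunk `StatMech`, family `crit-ising`). Companion
("Proofs") file of `InterfaceSLETightness.lean`, whose named fact
`Literature.Probability.LatticeModels.spinInterface_traversalBound` ((C1): the Aizenman–Burchard
hypothesis for the critical spin-Ising Dobrushin interfaces of Chelkak–Duminil-Copin–Hongler–
Kemppainen–Smirnov, C. R. Math. Acad. Sci. Paris 352 (2014), §2, *simultaneously for all
Dobrushin interfaces of the configuration*) is **not** discharged here.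

**Status of (C1).** CDHKS fix the interface by the leftmost (or rightmost) turning rule (§1: "We
assume `γ^δ` to be the rightmost (or the leftmost) interface … As we obtain the same limit for
all choices of `γ^δ`, the possible differences are only microscopic") and §2 (Thm. 3 =
Kemppainen–Smirnov, Condition G, Rem. 2, Rem. 4) prints the a-priori estimate for that single
exploration, whose domain Markov property drives the successive conditioning. That statement is
in the tree, proved modulo the FK-Ising RSW fact `fkIsing_rsw`:
`leftmostInterface_traversalBound_of_fkIsing_rsw` (`LeftmostInterfaceTightness.lean`), with the
tightness corollaries `exists_isTightMeasureSet_spinInterfaceLaw_leftmost`,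
`isTightAlongMesh_spinInterfaceCurve_leftmost` used by `InterfaceSLELeftmost.lean`. The event of
(C1) is the union over *all* Dobrushin interfaces of `σ` (`IsDobrushinInterface`: oriented
domain-wall trails, free to turn either way at a face with four alternating spins); a bound for it
is asserted but not proved in the cited sources (proviso (ii) of the docstring of (C1)).

**What is proved here** (elementary, recorded for the statement's owner and for any future
attempt): because the threshold `k(x, ρ, R)` of (C1) may depend on the shell, the power law
`K (ρ/R)^λ`, `λ > 2`, is implied by — so (C1) asks nothing beyond — the *rate-free* statement
that for every fixed shell `D(x; ρ, R)` the number of its traversals by the Dobrushin interfaces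
of the configuration is tight, uniformly in the admissible meshes `δ ≤ ρ`
(`spinInterface_traversalBound_of_shellTight`: choose `k(x, ρ, R)` with tail `≤ (ρ/R)^3`,
`K = 1`, `λ = 3`). For the leftmost interface this per-shell tightness is what the landed proof
establishes (geometric tails in `k`); for the union over all interfaces it is exactly the missing,
unprinted input (it requires controlling the faces with four alternating `±∗`-arms, where
interfaces may turn either way; cluster-counting and RSW-type bounds uniform in the boundary
conditions do not see thin alternating `∗`-webs).

## References

* D. Chelkak, H. Duminil-Copin, C. Hongler, A. Kemppainen, S. Smirnov, *Convergence of Ising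
  interfaces to Schramm's SLE curves*, C. R. Math. Acad. Sci. Paris 352 (2014) 157–161
  (arXiv:1312.0533): §1 (choice of the interface), §2 Thm. 3, Rem. 2, Rem. 4. [CDHKSCRAS2014]
* M. Aizenman, A. Burchard, *Hölder regularity and dimension bounds for random curves*, Duke
  Math. J. 99 (1999) 419–453: §1.b eq. (1.3), Thm. 1.1 (hypothesis H1 with a threshold).
  [AizenmanBurchardDuke1999]
-/

noncomputable section

open MeasureTheory Set
open scoped ENNReal

namespace Literature.Probability.LatticeModels

/-- **(C1) follows from per-shell tightness of the traversal counts, with no rate.** Because the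
threshold `k(x, ρ, R)` of `spinInterface_traversalBound` may depend on the shell, the power law
`K (ρ/R)^λ`, `λ > 2`, asks nothing beyond the following *rate-free* statement: for every shell
`D(x; ρ, R)` (`0 < ρ < R`) and every `ε > 0` there is a threshold `k` such that, for all
admissible meshes `δ ≤ ρ` below some `δ₀(D, E) > 0`, the event "some Dobrushin interface of `σ`
traverses `D(x; ρ, R)` by `k` separate segments" has probability `≤ ε` — i.e. the number of
traversals of each fixed shell by the Dobrushin interfaces of the configuration is tight,
uniformly in the mesh. Given this, take `k(x, ρ, R)` with tail `≤ (ρ/R)^3`, `K = 1`, `λ = 3`.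
(Elementary. CDHKS 2014, §1–§2 print the estimate for the leftmost/rightmost interface — landed,
modulo `fkIsing_rsw`, as `leftmostInterface_traversalBound_of_fkIsing_rsw`; for the union over
*all* interfaces of `σ` this per-shell tightness is precisely the statement that is not in
print.) [cite: CDHKSCRAS2014, §1 and §2 Thm. 3] [cite: AizenmanBurchardDuke1999, §1.b (1.3)] -/
theorem spinInterface_traversalBound_of_shellTight
    (h : ∀ (D : RandomPlanarGeometry.DobrushinDomain) (E : ℝ → DiscreteDobrushin),
      IsDiscretisation D E →
      ∃ δ₀ > (0 : ℝ), ∀ (x : ℂ) (ρ R ε : ℝ), 0 < ρ → ρ < R → 0 < ε → ∃ k : ℕ,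
        ∀ δ ∈ Set.Ioc (0 : ℝ) δ₀, (E δ).IsZdAdmissible → δ ≤ ρ →
          isingZdDobrushinMeasure (E δ) criticalBetaTwo
            {σ | ∃ γ, IsDobrushinInterface (E δ) σ γ ∧
              (spinPolygon δ γ).HasTraversals k x ρ R} ≤ ENNReal.ofReal ε) :
    spinInterface_traversalBound := by
  intro D E hE
  obtain ⟨δ₀, hδ₀, hk⟩ := h D E hE
  have key : ∀ (x : ℂ) (ρ R : ℝ), ∃ k : ℕ, 0 < ρ → ρ < R →
      ∀ δ ∈ Set.Ioc (0 : ℝ) δ₀, (E δ).IsZdAdmissible → δ ≤ ρ →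
        isingZdDobrushinMeasure (E δ) criticalBetaTwo
          {σ | ∃ γ, IsDobrushinInterface (E δ) σ γ ∧
            (spinPolygon δ γ).HasTraversals k x ρ R} ≤ ENNReal.ofReal ((ρ / R) ^ (3 : ℝ)) := by
    intro x ρ R
    by_cases hρ : 0 < ρ ∧ ρ < R
    · have hρ0 : 0 < ρ := hρ.1
      have hR : 0 < R := hρ0.trans hρ.2
      obtain ⟨k, hk'⟩ := hk x ρ R ((ρ / R) ^ (3 : ℝ)) hρ0 hρ.2 (by positivity)
      exact ⟨k, fun _ _ ↦ hk'⟩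
    · exact ⟨0, fun h₁ h₂ ↦ (hρ ⟨h₁, h₂⟩).elim⟩
  choose k hk using key
  refine ⟨k, 1, 3, δ₀, zero_le_one, by norm_num, hδ₀, fun δ hδ hadm x ρ R hδρ hρR _hR1 ↦ ?_⟩
  rw [one_mul]
  exact hk x ρ R (hδ.1.trans_le hδρ) hρR δ hδ hadm hδρ

end Literature.Probability.LatticeModels
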